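import Mathlib.GroupTheory.QuotientGroup.Basic
import Literature.AnabelianGeometry.EtaleTheta.Cyclotome
import Literature.IUT.HodgeArakelov.MonoThetaCyclotomes

/-!
# The cyclotome modulo `N` is the `N`-torsion: `Λ(A) ⊗ ℤ/Nℤ ≅ A[N]`

abc-iut cell, layer L6 (seat abc-iut-w5-d180); the "fine idle target" named by abc-iut-L6-lead
(§F v1.13, 2026-08-26T00:19:50Z) from abc-iut-w5-d215's SUBDAG-IUTchII-Prop-13ii row P13ii.r2:
S. Mochizuki, *Inter-universal Teichmüller theory II*, kurims ms., Proposition 1.3 (ii), p. 26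
l. 31–33: "`μ_N(S)` [cf. (i)] corresponds to `μ_Ẑ(M_TM) ⊗ (ℤ/Nℤ)` in the theory of [AbsTopIII], §3
[cf. [AbsTopIII], Definition 3.1, (v)]" — where `μ_Ẑ(M) := Hom(ℚ/ℤ, M) = lim_n M[n]` is the
cyclotome of a commutative group (tree: `Literature.AnabelianGeometry.EtaleTheta.cyclotome`,
LANA §6.1 p. 31) and `⊗ ℤ/Nℤ` of a multiplicatively written group is the reduction
`Literature.IUT.HodgeArakelov.ModPow A N = A ⧸ ⟪A^N⟫` ([IUTchII] Def 1.1 (ii), abc-iut-L6-t1).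

CLASSICAL CONTENT PROVED HERE (folklore; no named fact, no side taken on anything disputed):
for a commutative group `A`,
* `CyclotomeModN.eval N : Λ(A) →* A` (the level-`N` component) lands in the `N`-torsion
  `A[N] = ker (x ↦ x^N)` (`eval_mem_torsion`);
* its kernel is EXACTLY the subgroup of `N`-th powers of `Λ(A)` — with NO divisibility
  hypothesis (`ker_evalTorsion_eq_range_pow`: if `ζ_N = 1` then `n ↦ ζ_{nN}` is again a
  compatible system and its `N`-th power is `ζ`);
* if `A` is rootable (`RootableBy A ℕ`, e.g. `A = k̄^×` for an algebraically closed field),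
  `eval N` maps ONTO `A[N]` (`evalTorsion_surjective`: for `a ∈ A[N]` and a compatible root
  system `x` of `a`, `n ↦ (x n)^N` is a compatible system of torsion elements with level-`N`
  component `a`);
* hence the canonical isomorphisms `Λ(A)/Λ(A)^N ≃* A[N]` (`quotientPowEquivTorsion`) and, in
  abc-iut-L6-t1's vocabulary, **`ModPow (cyclotome A) N ≃* A[N]`** (`modPowEquivTorsion`), both
  induced by `ζ ↦ ζ_N` (`modPowEquivTorsion_mk`).
This is the bridge a MODEL instance of `Literature.IUT.HodgeArakelov.BsGalData` needs at the
datum `corr_muN : Z.muN ≃* muMTM` («μ_N(S)» ↔ «μ_Ẑ(M_TM) ⊗ ℤ/Nℤ») — cf. SUBDAG-IUTchII-Prop-13ii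
row P13ii.r2 (abc-iut-w5-d215) and abc-iut-w4-d042's `prop13_i_ii_of_thetaFrobenioid` (p411824).
-/

namespace Literature.IUT.HodgeArakelov.CyclotomeModN

open Function
open Literature.AnabelianGeometry.EtaleTheta Literature.AnabelianGeometry.EtaleTheta.cyclotome

universe u

variable {A : Type u} [CommGroup A]

/-- The `N`-torsion subgroup `A[N] = {a | a ^ N = 1}` of a commutative group, as the kernel of the
`N`-th power homomorphism. [folklore] -/
abbrev torsionBy (A : Type u) [CommGroup A] (N : ℕ+) : Subgroup A :=
  (powMonoidHom (N : ℕ) : A →* A).ker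

/-- Membership in `A[N]`. [cite: LANA2026Report, §6.1 p.31] (generalities on `Λ(M) = lim_n M^gp[n]`; classical) -/
theorem mem_torsionBy {N : ℕ+} {a : A} : a ∈ torsionBy A N ↔ a ^ (N : ℕ) = 1 := by
  simp [torsionBy, MonoidHom.mem_ker]

/-- The level-`N` component `Λ(A) → A`, `ζ ↦ ζ_N`, as a group homomorphism. [folklore] -/
def eval (N : ℕ+) : cyclotome A →* A :=
  (Pi.evalMonoidHom (fun _ : ℕ+ => A) N).comp (cyclotome A).subtype

/-- `eval N ζ = ζ N`. [cite: LANA2026Report, §6.1 p.31] (generalities on `Λ(M) = lim_n M^gp[n]`; classical) -/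
@[simp] theorem eval_apply (N : ℕ+) (ζ : cyclotome A) : eval N ζ = (ζ : ℕ+ → A) N := rfl

/-- The level-`N` component of an element of the cyclotome is `N`-torsion. [cite: LANA2026Report, §6.1 p.31] (generalities on `Λ(M) = lim_n M^gp[n]`; classical) -/
theorem eval_mem_torsionBy (N : ℕ+) (ζ : cyclotome A) : eval N ζ ∈ torsionBy A N :=
  mem_torsionBy.2 (pow_eq_one ζ N)

/-- `ζ ↦ ζ_N` as a homomorphism `Λ(A) →* A[N]`. [folklore] -/
def evalTorsion (N : ℕ+) : cyclotome A →* torsionBy A N :=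
  (eval N).codRestrict _ (eval_mem_torsionBy N)

/-- `evalTorsion N ζ = ζ N` on underlying elements. [cite: LANA2026Report, §6.1 p.31] (generalities on `Λ(M) = lim_n M^gp[n]`; classical) -/
@[simp] theorem coe_evalTorsion (N : ℕ+) (ζ : cyclotome A) :
    (evalTorsion N ζ : A) = (ζ : ℕ+ → A) N := rfl

/-- **`N`-th roots inside the cyclotome.** If `ζ ∈ Λ(A)` has trivial level-`N` component, then
`n ↦ ζ_{n·N}` is again a compatible system of torsion elements. [folklore] -/
def rootShift (N : ℕ+) (ζ : cyclotome A) (hζ : (ζ : ℕ+ → A) N = 1) : cyclotome A :=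
  ⟨fun n => (ζ : ℕ+ → A) (n * N), by
    refine ⟨fun n => ?_, fun n m => ?_⟩
    · -- `ζ_{nN} ^ n = ζ_N = 1`
      have h := pow_apply_mul ζ N n
      rw [mul_comm N n] at h
      rw [h, hζ]
    · -- `ζ_{nmN} ^ m = ζ_{nN}`
      have h := pow_apply_mul ζ (n * N) m
      rwa [mul_right_comm n N m] at h⟩

/-- Components of `rootShift`. [cite: LANA2026Report, §6.1 p.31] (generalities on `Λ(M) = lim_n M^gp[n]`; classical) -/
@[simp] theorem coe_rootShift_apply (N : ℕ+) (ζ : cyclotome A) (hζ : (ζ : ℕ+ → A) N = 1)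
    (n : ℕ+) : ((rootShift N ζ hζ : cyclotome A) : ℕ+ → A) n = (ζ : ℕ+ → A) (n * N) := rfl

/-- `(rootShift N ζ)^N = ζ`: an element of the cyclotome with trivial level-`N` component is an
`N`-th power in the cyclotome. [cite: LANA2026Report, §6.1 p.31] (generalities on `Λ(M) = lim_n M^gp[n]`; classical) -/
theorem rootShift_pow (N : ℕ+) (ζ : cyclotome A) (hζ : (ζ : ℕ+ → A) N = 1) :
    rootShift N ζ hζ ^ (N : ℕ) = ζ := by
  apply Subtype.ext
  funext n
  simp only [SubgroupClass.coe_pow, Pi.pow_apply, coe_rootShift_apply]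
  exact pow_apply_mul ζ n N

/-- **Kernel = `N`-th powers** (no divisibility hypothesis): `ζ_N = 1 ↔ ζ ∈ Λ(A)^N`.
[cite: LANA2026Report, §6.1 p.31] (generalities on `Λ(M) = lim_n M^gp[n]`; classical) -/
theorem ker_evalTorsion_eq_range_pow (N : ℕ+) :
    (evalTorsion (A := A) N).ker = (powMonoidHom (N : ℕ) : cyclotome A →* cyclotome A).range := by
  ext ζ
  constructor
  · intro hζ
    have hN : (ζ : ℕ+ → A) N = 1 := by
      have := congrArg (fun x : torsionBy A N => (x : A)) (MonoidHom.mem_ker.1 hζ)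
      simpa using this
    exact ⟨rootShift N ζ hN, by simp [rootShift_pow]⟩
  · rintro ⟨ξ, rfl⟩
    rw [MonoidHom.mem_ker]
    apply Subtype.ext
    simp [pow_eq_one ξ N]

/-- The kernel of `ζ ↦ ζ_N` on `Λ(A)` is the subgroup of `N`-th powers. [cite: LANA2026Report, §6.1 p.31] (generalities on `Λ(M) = lim_n M^gp[n]`; classical) -/
theorem ker_eval_eq_range_pow (N : ℕ+) :
    (eval (A := A) N).ker = (powMonoidHom (N : ℕ) : cyclotome A →* cyclotome A).range := by
  rw [← ker_evalTorsion_eq_range_pow]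
  ext ζ
  simp only [MonoidHom.mem_ker, eval_apply]
  constructor
  · intro h; exact Subtype.ext (by simpa using h)
  · intro h; simpa using congrArg (fun x : torsionBy A N => (x : A)) h

/-- From a compatible root system `x` of an `N`-torsion element `a`, the family `n ↦ (x n)^N` is a
compatible system of torsion elements, i.e. an element of `Λ(A)`, with level-`N` component
`(x N)^N = a`. [cite: LANA2026Report, §6.1 p.31] (generalities on `Λ(M) = lim_n M^gp[n]`; classical) -/
def ofTorsion (N : ℕ+) (a : A) (ha : a ^ (N : ℕ) = 1) (x : RootSystem a) : cyclotome A :=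
  ⟨fun n => x.root n ^ (N : ℕ), by
    refine ⟨fun n => ?_, fun n m => ?_⟩
    · rw [← pow_mul, mul_comm (N : ℕ) (n : ℕ), pow_mul, x.pow_self n, ha]
    · rw [← pow_mul, mul_comm (N : ℕ) (m : ℕ), pow_mul, x.root_mul_pow n m]⟩

/-- Components of `ofTorsion`. [cite: LANA2026Report, §6.1 p.31] (generalities on `Λ(M) = lim_n M^gp[n]`; classical) -/
@[simp] theorem coe_ofTorsion_apply (N : ℕ+) (a : A) (ha : a ^ (N : ℕ) = 1) (x : RootSystem a)
    (n : ℕ+) : ((ofTorsion N a ha x : cyclotome A) : ℕ+ → A) n = x.root n ^ (N : ℕ) := rfl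

/-- The level-`N` component of `ofTorsion N a _ x` is `a`. [cite: LANA2026Report, §6.1 p.31] (generalities on `Λ(M) = lim_n M^gp[n]`; classical) -/
theorem eval_ofTorsion (N : ℕ+) (a : A) (ha : a ^ (N : ℕ) = 1) (x : RootSystem a) :
    eval N (ofTorsion N a ha x) = a := by
  simp [x.pow_self N]

section Rootable

variable [RootableBy A ℕ]

/-- **Surjectivity onto the `N`-torsion** for a rootable (divisible) commutative group: every
`a ∈ A[N]` is the level-`N` component of some element of `Λ(A)`. [cite: LANA2026Report, §6.1 p.31] (generalities on `Λ(M) = lim_n M^gp[n]`; classical) -/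
theorem evalTorsion_surjective (N : ℕ+) : Surjective (evalTorsion (A := A) N) := by
  rintro ⟨a, ha⟩
  refine ⟨ofTorsion N a (mem_torsionBy.1 ha) (RootSystem.ofRootableBy a), Subtype.ext ?_⟩
  simpa using eval_ofTorsion N a (mem_torsionBy.1 ha) (RootSystem.ofRootableBy a)

/-- **`Λ(A)/Λ(A)^N ≃* A[N]`** for a rootable commutative group `A`, induced by `ζ ↦ ζ_N`.
[cite: Mochizuki2012, IUTchII Prop 1.3 (ii) p.26] («μ_N(S)» ↔ «μ_Ẑ(M_TM) ⊗ (ℤ/Nℤ)»; the classical identification behind the printed correspondence — D-0012 claim key, the correspondence itself is not asserted here) -/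
noncomputable def quotientPowEquivTorsion (N : ℕ+) :
    cyclotome A ⧸ (powMonoidHom (N : ℕ) : cyclotome A →* cyclotome A).range ≃* torsionBy A N :=
  (QuotientGroup.quotientMulEquivOfEq (ker_evalTorsion_eq_range_pow N)).symm.trans
    (QuotientGroup.quotientKerEquivOfSurjective _ (evalTorsion_surjective N))

/-- The isomorphism `Λ(A)/Λ(A)^N ≃* A[N]` sends the class of `ζ` to `ζ_N`. [cite: Mochizuki2012, IUTchII Prop 1.3 (ii) p.26] («μ_N(S)» ↔ «μ_Ẑ(M_TM) ⊗ (ℤ/Nℤ)»; the classical identification behind the printed correspondence — D-0012 claim key, the correspondence itself is not asserted here) -/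
@[simp] theorem quotientPowEquivTorsion_mk (N : ℕ+) (ζ : cyclotome A) :
    (quotientPowEquivTorsion N (QuotientGroup.mk ζ) : A) = (ζ : ℕ+ → A) N := rfl

/-- In a commutative group the normal closure of the set of `N`-th powers is the range of the
`N`-th power homomorphism (abc-iut-L6-t1's `ModPow A N := A ⧸ normalClosure {a^N}`). [cite: Mochizuki2012, IUTchII Prop 1.3 (ii) p.26] («μ_N(S)» ↔ «μ_Ẑ(M_TM) ⊗ (ℤ/Nℤ)»; the classical identification behind the printed correspondence — D-0012 claim key, the correspondence itself is not asserted here) -/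
theorem normalClosure_range_pow_eq (B : Type u) [CommGroup B] (N : ℕ) :
    Subgroup.normalClosure (Set.range fun b : B => b ^ N) = (powMonoidHom N : B →* B).range := by
  apply le_antisymm
  · apply Subgroup.normalClosure_le_normal
    rintro _ ⟨b, rfl⟩
    exact ⟨b, rfl⟩
  · rintro _ ⟨b, rfl⟩
    exact Subgroup.subset_normalClosure ⟨b, rfl⟩

/-- **[IUTchII] Prop 1.3 (ii) bridge «μ_Ẑ(M) ⊗ ℤ/Nℤ ≅ μ_N»** in the cell's vocabulary: for a
rootable commutative group `A` (e.g. `k̄^×`), abc-iut-L6-t1's reduction `ModPow (Λ(A)) N =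
Λ(A) ⧸ ⟪Λ(A)^N⟫` of the cyclotome is canonically isomorphic to the `N`-torsion `A[N]`, via
`ζ ↦ ζ_N`. [cite: Mochizuki2012, IUTchII Prop 1.3 (ii) p.26] («μ_N(S)» ↔ «μ_Ẑ(M_TM) ⊗ (ℤ/Nℤ)»; the classical identification behind the printed correspondence — D-0012 claim key, the correspondence itself is not asserted here) (classical: `Hom(ℚ/ℤ, A) ⊗ ℤ/N ≅ A[N]` for divisible torsion) -/
noncomputable def modPowEquivTorsion (N : ℕ+) :
    Literature.IUT.HodgeArakelov.ModPow (cyclotome A) (N : ℕ) ≃* torsionBy A N :=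
  (QuotientGroup.quotientMulEquivOfEq (normalClosure_range_pow_eq (cyclotome A) N)).trans
    (quotientPowEquivTorsion N)

/-- `modPowEquivTorsion` sends the class of `ζ` to `ζ_N`. [cite: Mochizuki2012, IUTchII Prop 1.3 (ii) p.26] («μ_N(S)» ↔ «μ_Ẑ(M_TM) ⊗ (ℤ/Nℤ)»; the classical identification behind the printed correspondence — D-0012 claim key, the correspondence itself is not asserted here) -/
@[simp] theorem modPowEquivTorsion_mk (N : ℕ+) (ζ : cyclotome A) :
    (modPowEquivTorsion N (QuotientGroup.mk ζ) : A) = (ζ : ℕ+ → A) N := rfl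

/-- Non-vacuity / sanity: the class of `1` goes to `1`. [folklore] -/
example (N : ℕ+) : (modPowEquivTorsion (A := A) N (QuotientGroup.mk 1) : A) = 1 := by simp

end Rootable

end Literature.IUT.HodgeArakelov.CyclotomeModN
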